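import Mathlib
import Literature.Probability.RandomPlanarGeometry.ChordalCurveFamily
import HarnessLib

/-!
# The restriction property in functional (`lintegral`) form

Crux `AxiomsOfLimit` (stmt-CriticalPhenomena-1370), line `registered`, stub
`stub_restriction_lintegral` (lead c5, wave 1). Theorems only.

The two-sided restriction property `ChordalFamily.IsRestriction P` says, for Dobrushin domains
`E ⊆ D` pinned at the same two marked points and every measurable `T`,
`P E T · P D R = P D (T ∩ R)` with `R := {γ ⊆ closure E}` (`CurveClass.rangeSubset`), i.e.
`P E` is `P D` conditioned on the curve staying in `closure E`, in product form. Equivalently the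
two measures `(P D R) • P E` and `(P D)|_R` agree on measurable sets, hence are equal; integrating a
function `g` against both gives the functional form
`(∫⁻ g ∂P E) · P D R = ∫⁻ g ∂(P D)|_R`.

References: G. F. Lawler, O. Schramm, W. Werner, *Conformal restriction: the chordal case* (2003)
§1 p. 4, §3. All [folklore].
-/

noncomputable section

open MeasureTheory Set
open scoped ENNReal

namespace Summit.CriticalPhenomena.SAWScalingLimit.Theorems.AxiomsOfLimitKernelClause

open Literature.Probability.RandomPlanarGeometry

namespace RestrictionLintegral

/-- **Product-form conditioning as an equality of measures.** If two measures `μ, ν` satisfy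
`μ T · ν R = ν (T ∩ R)` for every measurable `T`, then `(ν R) • μ = ν|_R`. [folklore] -/
theorem smul_eq_restrict_of_forall {α : Type*} [MeasurableSpace α] {μ ν : Measure α} {R : Set α}
    (h : ∀ T : Set α, MeasurableSet T → μ T * ν R = ν (T ∩ R)) :
    ν R • μ = ν.restrict R := by
  refine Measure.ext fun T hT => ?_
  rw [Measure.smul_apply, smul_eq_mul, mul_comm, h T hT, Measure.restrict_apply hT]

/-- **Product-form conditioning, functional form.** If `μ T · ν R = ν (T ∩ R)` for every
measurable `T`, then `(∫⁻ g ∂μ) · ν R = ∫⁻ g ∂ν|_R` for every `g : α → ℝ≥0∞`. [folklore] -/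
theorem lintegral_mul_eq_setLIntegral_of_forall {α : Type*} [MeasurableSpace α]
    {μ ν : Measure α} {R : Set α}
    (h : ∀ T : Set α, MeasurableSet T → μ T * ν R = ν (T ∩ R)) (g : α → ℝ≥0∞) :
    (∫⁻ x, g x ∂μ) * ν R = ∫⁻ x in R, g x ∂ν := by
  rw [← smul_eq_restrict_of_forall h, lintegral_smul_measure, smul_eq_mul, mul_comm]

end RestrictionLintegral

/-- **The restriction property (i) in functional form.** If `P` has the two-sided restriction
property, then for Dobrushin domains `E ⊆ D` with the same marked points and every
`g : CurveClass ℂ → ℝ≥0∞`,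
`(∫⁻ g ∂P E) · P D {γ ⊆ closure E} = ∫⁻_{γ ⊆ closure E} g ∂(P D)`: the law `P E` is `P D`
conditioned on the curve staying in `closure E` (product form), integrated against `g`.
[folklore] -/
theorem stub_restriction_lintegral : ∀ (P : Literature.Probability.RandomPlanarGeometry.ChordalFamily), P.IsRestriction → ∀ (D E : Literature.Probability.RandomPlanarGeometry.DobrushinDomain), E.carrier ⊆ D.carrier → E.pt 0 = D.pt 0 → E.pt 1 = D.pt 1 → ∀ (g : Literature.Probability.RandomPlanarGeometry.CurveClass ℂ → ENNReal), Measurable g → MeasureTheory.lintegral (P E) g * P D (Literature.Probability.RandomPlanarGeometry.CurveClass.rangeSubset (closure E.carrier)) = MeasureTheory.lintegral ((P D).restrict (Literature.Probability.RandomPlanarGeometry.CurveClass.rangeSubset (closure E.carrier))) g := by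
  intro P hR D E hsub h0 h1 g _
  exact RestrictionLintegral.lintegral_mul_eq_setLIntegral_of_forall
    (fun T hT => hR D E hsub h0 h1 T hT) g

end Summit.CriticalPhenomena.SAWScalingLimit.Theorems.AxiomsOfLimitKernelClause

end
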